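import Literature.NumberTheory.EllipticCurves.ZpExtensionEisensteinDVRSettingH4PerfectProofs
import Literature.NumberTheory.EllipticCurves.ZpExtensionEisensteinTowerDivisionProofs
import HarnessLib

/-!
# H.4 at the places `v ∈ S` for the curve's Eisenstein setting, III: the projection formula (Adj) of the
# descent, instantiated (the value maps `×p^d` on `A_{m,•}(1)`, the divisions `×p^d` on the levels)

`Proofs` file (theorems only; no definition, no named fact, no instance, no `sorry`).  Sequel of
`ZpExtensionEisensteinDVRSettingH4TowerPairingProofs` ((hB), (hQ), (T)) and
`ZpExtensionEisensteinDVRSettingH4PerfectProofs` ((Perf), (Nondeg)).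

Howard 2004, H.4 at a finite place `v` for `F_𝔮` (Def. 3.1.2) is obtained in the tree from the abstract descent over
the tower of induced local pairings `∪_j : H¹(K_v, T^{(j)}) × H¹(K_v, Tw T^{(j)}) → H²(K_v, A_{m,j+1}(1))` of the curve's
tower `T^{(j)} = E_K[p^{j+1}] ⊗ A_{m,j+1}(ψ)` (`W.eisensteinTower κ hm`).  Its duality clause (Dual) is
`Tower.mem_levelCondition_top_of_forall_pairing_bot_eq_zero_of_range`, whose level input

  (Adj) `incQ d (B k x (red′^{(d)} w)) = B (k + d) (up d x) w`

is the projection formula of the cup product for the level maps `up_d = H¹(×p^d : T^{(k)} ↪ T^{(k+d)})` and the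
comparison maps `incQ_d = H²(×p^d : A_{m,k+1}(1) ↪ A_{m,k+d+1}(1))` of the value groups.  The generic cup-product
identity is `DualityDatum.localCup_map_adjoint'` (x9-p1-w4); this file supplies its three module-level inputs for the
curve's tower and ANY family of H.4 data `D k` over `A_{m,k+1}` satisfying the reduction identity `he_red` of the
setting (`SatisfiesH.e_red`, the binder of `eisensteinDVRSetting_satisfiesH_ofLifts_of`), and packages the result:

* §1 (pure algebra of `A_{m,k} = Λ/(T^m + p, p^k)`) the VALUE MAPS `ι : A_{m,k} → A_{m,k'}`, «`×p^{k'−k}` along the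
  reduction»: `exists_addMonoidHom_apply_reduce_eq_pow_smul` (`∃ ι, ι ∘ reduce = p^{k'−k} •`, since `ker reduce =
  p^k A_{m,k'}` is killed by `p^{k'−k}`), and `twistOne_apply_of_apply_reduce` (any such `ι` intertwines the Tate
  twists `A_{m,k}(1) → A_{m,k'}(1)` of any two H.4 data — the hypothesis `hφ` of `localCup_map_adjoint'`);
* §2 (tower algebra) `eisensteinTower_redIter_eq_eisensteinTwistTorsionTransfer`: the iterated reduction
  `red^{(d)} : T^{(k+d)} → T^{(k)}` of the curve's tower IS the two-index map `F (k+d+1) (k+1)` of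
  `ZpExtensionEisensteinTowerDivisionProofs`, hence `F (k+1) (k+d+1) ∘ red^{(d)} = p^d •`
  (`eisensteinTwistTorsionTransfer_redIter`); and `reduce_e_redIter`: the ITERATED reduction identity
  `reduce (e_{k+d}(x, y)) = e_k(red^{(d)} x, red^{(d)} y)` from `he_red`;
* §3 (Adj) `eisensteinTower_localCup_adjoint`: `H²(ι_d(1)) (x ∪_k H¹(red^{(d)}) w) = H¹(F (k+1) (k+d+1)) x ∪_{k+d} w`
  — `localCup_map_adjoint'` at `u := F (k+1) (k+d+1)`, `r := red^{(d)}`, `φ := ι_d`, whose pairing clause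
  `ι_d (e_k(s, red^{(d)} t)) = e_{k+d}(F s, t)` is §2 plus bilinearity (no input on `D` beyond `he_red`);
* §4 the same in the binder shape `hAdj` of `Tower.mem_levelCondition_top_of_forall_pairing_bot_eq_zero_of_range`
  for the `D`-indexed towers `X_j = H¹(K_v, T^{(j)})`, `Y_j = H¹(K_v, Tw T^{(j)})` (one-step maps `H¹(red_j)`),
  `B_j = (D j).localCup v`, `up d := H¹(K_v, F (k+1) (k+d+1))`
  (`galoisCohomology.map (DiscreteGaloisModule.localMap _ v) 1`, the currency of the (Ker) input
  `Tower.ker_map_up_le_levelCondition_bot`), `incQ d := H²(K_v, ι_d(1))`, together with the existence of the family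
  `ι_d` (`eisensteinTower_localCup_towerAdjoint`).

Cell `pub/bsd-print-x9` (STUB A, `hfin4`); (Ker), (Exact) and core isotropy (hC) are other files.  No summit statement
is proved here; BSD is not proved by any of this.  References: [Howard2004HeegnerKolyvagin] §1.1 Def. 1.1.3, §1.3 H.4
(arXiv:1202.6340 p. 7 L78–82), §1.6 (p. 11 L33–38, p. 12 L29–33), Def. 3.1.2; [NeukirchSchmidtWingberg2008] I §4
(1.4.2)–(1.4.6) (naturality and projection formula of the cup product); [MilneADT2006] I Cor. 2.3;
[SerreGaloisCohomology1997] I §2.2.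
-/

set_option autoImplicit false

noncomputable section

open Function NumberField IsDedekindDomain Field
open scoped NumberField ContRepresentation

/-! ## §1 The value maps `×p^{k'−k} : A_{m,k} → A_{m,k'}` along the reduction -/

namespace Literature.NumberTheory.EllipticCurves.IwasawaAlgebra.EisensteinCoeff

variable {p : ℕ} [hp : Fact p.Prime]

/-- `p^{k'−k}` kills the kernel `p^k A_{m,k'}` of the reduction `A_{m,k'} → A_{m,k}` (`k ≤ k'`).
[cite: Howard2004HeegnerKolyvagin, §2.2 (A_{m,k} = Λ/(𝔮, p^k)) and Def. 1.1.3] -/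
theorem pow_sub_smul_eq_zero_of_reduce_eq_zero (m : ℕ) {k k' : ℕ} (hkk' : k ≤ k') (x : EisensteinCoeff p m k')
    (hx : reduce p m hkk' x = 0) : p ^ (k' - k) • x = 0 := by
  obtain ⟨c, rfl⟩ := (reduce_eq_zero_iff m hkk' x).1 hx
  rw [nsmul_eq_mul, Nat.cast_pow, mul_left_comm, ← pow_add, Nat.sub_add_cancel hkk',
    natCast_pow_eq_zero_quotient p m k', mul_zero]

/-- **The value map `ι : A_{m,k} → A_{m,k'}`, «`×p^{k'−k}` along the reduction»** (`k ≤ k'`): an additive map with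
`ι (reduce x) = p^{k'−k} · x` — the map `R/p^k ↪ R/p^{k'}` of `Quot` induced by `p^{k'−k}` on the value rings of
the tower of pairings (it exists since `ker reduce = p^k A_{m,k'}` is killed by `p^{k'−k}`).
[cite: Howard2004HeegnerKolyvagin, Def. 1.1.3 (arXiv Def. 2.1.3) and §1.6 (arXiv p. 11, L33–38)] -/
theorem exists_addMonoidHom_apply_reduce_eq_pow_smul (m : ℕ) {k k' : ℕ} (hkk' : k ≤ k') :
    ∃ ι : EisensteinCoeff p m k →+ EisensteinCoeff p m k',
      ∀ x : EisensteinCoeff p m k', ι (reduce p m hkk' x) = p ^ (k' - k) • x := by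
  let g : EisensteinCoeff p m k' →+ EisensteinCoeff p m k' :=
    AddMonoidHom.mk' (fun x ↦ p ^ (k' - k) • x) fun x y ↦ smul_add _ _ _
  have hg : (reduce p m hkk').toAddMonoidHom.ker ≤ g.ker := fun x hx ↦
    (AddMonoidHom.mem_ker).2 (pow_sub_smul_eq_zero_of_reduce_eq_zero m hkk' x ((AddMonoidHom.mem_ker).1 hx))
  exact ⟨(reduce p m hkk').toAddMonoidHom.liftOfSurjective (reduce_surjective m hkk') ⟨g, hg⟩, fun x ↦
    (reduce p m hkk').toAddMonoidHom.liftOfRightInverse_comp_apply _ _ ⟨g, hg⟩ x⟩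

/-- The same for a whole family of exponents `d ↦ (k ≤ k + d)` (by choice), in the index shape of the descent's
`incQ : ∀ d, Q k →+ Q (k + d)` for the `D`-indexed value rings `A_{m,k+1}`.
[cite: Howard2004HeegnerKolyvagin, Def. 1.1.3 and §1.6 (arXiv p. 11, L33–38)] -/
theorem exists_forall_addMonoidHom_apply_reduce_eq_pow_smul (m k : ℕ) :
    ∃ ι : ∀ d : ℕ, EisensteinCoeff p m (k + 1) →+ EisensteinCoeff p m (k + d + 1),
      ∀ (d : ℕ) (x : EisensteinCoeff p m (k + d + 1)),
        ι d (reduce p m (Nat.succ_le_succ (Nat.le_add_right k d)) x) = p ^ d • x := by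
  choose ι hι using fun d ↦
    exists_addMonoidHom_apply_reduce_eq_pow_smul (p := p) m (Nat.succ_le_succ (Nat.le_add_right k d))
  refine ⟨ι, fun d x ↦ ?_⟩
  rw [hι d x, show k + d + 1 - (k + 1) = d by omega]

end Literature.NumberTheory.EllipticCurves.IwasawaAlgebra.EisensteinCoeff

namespace Literature.NumberTheory.GaloisCohomology.Howard2004.DualityDatum

open Literature.NumberTheory.GaloisRepresentations Literature.NumberTheory.EllipticCurves.IwasawaAlgebra

variable {K : Type} [Field K] [NumberField K] {p : ℕ} [hp : Fact p.Prime] {cd : ConjugationDatum K}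
  {M₁ : Type} [AddCommGroup M₁] [TopologicalSpace M₁] [DiscreteTopology M₁]
  {M₂ : Type} [AddCommGroup M₂] [TopologicalSpace M₂] [DiscreteTopology M₂]
  {m k k' : ℕ} [Module (EisensteinCoeff p m k) M₁] [Module (EisensteinCoeff p m k') M₂]
  {ρ₁ : DiscreteGaloisModule K M₁} {ρ₂ : DiscreteGaloisModule K M₂}

/-- **(hφ) A value map `×p^{k'−k}` along the reduction intertwines the Tate twists `A_{m,k}(1) → A_{m,k'}(1)`** of ANY
two H.4 data (both twists are `χ(g) ·`, `twistOne_apply`; `reduce` is a `ℤ_p`-algebra map and is surjective).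
[cite: Howard2004HeegnerKolyvagin, §1.3 H.4 (arXiv p. 7, L69–73: R(1)) and §2.2] -/
theorem twistOne_apply_of_apply_reduce (D₁ : DualityDatum p cd ρ₁ (EisensteinCoeff p m k))
    (D₂ : DualityDatum p cd ρ₂ (EisensteinCoeff p m k')) (hkk' : k ≤ k')
    (ι : EisensteinCoeff p m k →+ EisensteinCoeff p m k') (n : ℕ)
    (hι : ∀ x : EisensteinCoeff p m k', ι (EisensteinCoeff.reduce p m hkk' x) = n • x)
    (g : absoluteGaloisGroup K) (x : EisensteinCoeff p m k) :
    ι (D₁.twistOne g x) = D₂.twistOne g (ι x) := by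
  obtain ⟨y, rfl⟩ := EisensteinCoeff.reduce_surjective m hkk' x
  rw [D₁.twistOne_apply, D₂.twistOne_apply, ← EisensteinCoeff.reduce_algebraMap m hkk', ← map_mul, hι, hι,
    nsmul_eq_mul, nsmul_eq_mul, mul_left_comm]

end Literature.NumberTheory.GaloisCohomology.Howard2004.DualityDatum

/-! ## §§2–4 The curve's Eisenstein tower -/

namespace WeierstrassCurve

open Literature.NumberTheory.EllipticCurves Literature.NumberTheory.GaloisRepresentations
open Literature.NumberTheory.GaloisRepresentations.DiscreteGaloisModule
open Literature.NumberTheory.GaloisCohomology Literature.NumberTheory.GaloisCohomology.Howard2004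
open Literature.NumberTheory.EllipticCurves.ZpExtension (EisensteinLevel)

variable {K : Type} [Field K] [NumberField K] (W : WeierstrassCurve ℚ) [W.IsElliptic] {p : ℕ} [hp : Fact p.Prime]
  (κ : ZpExtension K p) {m : ℕ} (hm : 1 ≤ m)

/-! ### §2 The iterated reduction is the two-index map `F (k+d+1) (k+1)`; `F ∘ red^{(d)} = p^d`; `he_red^{(d)}` -/

omit [W.IsElliptic] hp in
/-- The transition `P ↦ p • P` of the torsion modules `E_K[p^{k+1}] → E_K[p^k]` satisfies the hypothesis `ht` of the
two-index family (definitionally). [cite: SilvermanAEC2009, III.§7] -/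
theorem torsionGaloisModuleReduce_coe (k : ℕ) (P : geomTorsion (W.baseChange K) ((p : ℤ) ^ (k + 1))) :
    (((W.baseChange K).torsionGaloisModuleReduce p k P : geomTorsion (W.baseChange K) ((p : ℤ) ^ k)) :
        geomPoints (W.baseChange K)) = (p : ℤ) • (P : geomPoints (W.baseChange K)) :=
  rfl

/-- **One reduction step of the curve's tower is the two-index map `F (j+2) (j+1)`** of
`ZpExtensionEisensteinTowerDivisionProofs` (both are `eisensteinTwistReduce` along `×p`).
[cite: Howard2004HeegnerKolyvagin, §1.6 (arXiv p. 12, L29–33) and §2.2] -/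
theorem eisensteinTower_red_eq_eisensteinTwistTorsionTransfer (j : ℕ)
    (x : EisensteinLevel p m (fun j ↦ geomTorsion (W.baseChange K) ((p : ℤ) ^ j)) (j + 1 + 1)) :
    letI := IwasawaAlgebra.isLocalRing_quotient_X_pow_add_C p hm
    (W.eisensteinTower κ hm).red j x =
      (W.baseChange K).eisensteinTwistTorsionTransfer κ hm (fun j ↦ (W.baseChange K).torsionGaloisModuleReduce p j)
        (W.torsionGaloisModuleReduce_coe (K := K) (p := p)) (j + 1 + 1) (j + 1)
        (x : IwasawaAlgebra.EisensteinCoeff.Twisted p m (j + 1 + 1) (geomTorsion (W.baseChange K) ((p : ℤ) ^ (j + 1 + 1)))) := by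
  rw [eisensteinTwistTorsionTransfer_eq, ZpExtension.eisensteinTwistTransfer_succ_self]
  rfl

/-- **The iterated reduction `red^{(d)} : T^{(k+d)} → T^{(k)}` of the curve's tower is the two-index map
`F (k+d+1) (k+1)`.** [cite: Howard2004HeegnerKolyvagin, Def. 1.1.3 and §1.6 (arXiv p. 12, L29–33)] -/
theorem eisensteinTower_redIter_eq_eisensteinTwistTorsionTransfer (k d : ℕ)
    (x : EisensteinLevel p m (fun j ↦ geomTorsion (W.baseChange K) ((p : ℤ) ^ j)) (k + d + 1)) :
    letI := IwasawaAlgebra.isLocalRing_quotient_X_pow_add_C p hm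
    (W.eisensteinTower κ hm).redIter k d x =
      (W.baseChange K).eisensteinTwistTorsionTransfer κ hm (fun j ↦ (W.baseChange K).torsionGaloisModuleReduce p j)
        (W.torsionGaloisModuleReduce_coe (K := K) (p := p)) (k + d + 1) (k + 1)
        (x : IwasawaAlgebra.EisensteinCoeff.Twisted p m (k + d + 1)
          (geomTorsion (W.baseChange K) ((p : ℤ) ^ (k + d + 1)))) := by
  letI := IwasawaAlgebra.isLocalRing_quotient_X_pow_add_C p hm
  induction d with
  | zero =>
    change x = _
    rw [eisensteinTwistTorsionTransfer_eq, ZpExtension.eisensteinTwistTransfer_self]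
  | succ d ih =>
    change (W.eisensteinTower κ hm).redIter k d ((W.eisensteinTower κ hm).red (k + d) x) = _
    rw [W.eisensteinTower_red_eq_eisensteinTwistTorsionTransfer κ hm (k + d) x, ih, eisensteinTwistTorsionTransfer_eq,
      eisensteinTwistTorsionTransfer_eq, eisensteinTwistTorsionTransfer_eq,
      ZpExtension.eisensteinTwistTransfer_comp _ _ _ _ _ _ _ (Nat.succ_le_succ (Nat.le_add_right k d))
        (Nat.le_succ (k + d + 1))]
    rfl

/-- **`F (k+1) (k+d+1) (red^{(d)} x) = p^d · x`**: the division `×p^d : T^{(k)} ↪ T^{(k+d)}` after the iterated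
reduction is multiplication by `p^d` on `T^{(k+d)}`. [cite: Howard2004HeegnerKolyvagin, Def. 1.1.3 (arXiv Def. 2.1.3) and §1.6] -/
theorem eisensteinTwistTorsionTransfer_redIter (k d : ℕ)
    (x : EisensteinLevel p m (fun j ↦ geomTorsion (W.baseChange K) ((p : ℤ) ^ j)) (k + d + 1)) :
    letI := IwasawaAlgebra.isLocalRing_quotient_X_pow_add_C p hm
    (W.baseChange K).eisensteinTwistTorsionTransfer κ hm (fun j ↦ (W.baseChange K).torsionGaloisModuleReduce p j)
        (W.torsionGaloisModuleReduce_coe (K := K) (p := p)) (k + 1) (k + d + 1)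
        ((W.eisensteinTower κ hm).redIter k d x :
          IwasawaAlgebra.EisensteinCoeff.Twisted p m (k + 1) (geomTorsion (W.baseChange K) ((p : ℤ) ^ (k + 1)))) =
      ((p ^ d • x : EisensteinLevel p m (fun j ↦ geomTorsion (W.baseChange K) ((p : ℤ) ^ j)) (k + d + 1)) :
        IwasawaAlgebra.EisensteinCoeff.Twisted p m (k + d + 1) (geomTorsion (W.baseChange K) ((p : ℤ) ^ (k + d + 1)))) := by
  letI := IwasawaAlgebra.isLocalRing_quotient_X_pow_add_C p hm
  have h := W.eisensteinTower_redIter_eq_eisensteinTwistTorsionTransfer κ hm k d x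
  rw [h, eisensteinTwistTorsionTransfer_eq, eisensteinTwistTorsionTransfer_eq,
    ZpExtension.eisensteinTwistTransfer_apply_apply _ _ _ _ _ _ _ (Nat.succ_le_succ (Nat.le_add_right k d)),
    show k + d + 1 - (k + 1) = d by omega]
  rfl

variable (cd : ConjugationDatum K)
  (D : letI := IwasawaAlgebra.isLocalRing_quotient_X_pow_add_C p hm
    ∀ k, DualityDatum p cd ((W.eisensteinTower κ hm).ρ k) (IwasawaAlgebra.EisensteinCoeff p m (k + 1)))

/-- **The iterated reduction identity of the pairings**: from the one-step identity `he_red` of the setting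
(`SatisfiesH.e_red`), `reduce (e_{k+d}(x, y)) = e_k(red^{(d)} x, red^{(d)} y)` for all `d`.
[cite: Howard2004HeegnerKolyvagin, §1.6 (arXiv p. 11, L33–38: the pairings of the tower are compatible)] -/
theorem reduce_e_redIter
    (he_red : letI := IwasawaAlgebra.isLocalRing_quotient_X_pow_add_C p hm
      ∀ k (x y : EisensteinLevel p m (fun j ↦ geomTorsion (W.baseChange K) ((p : ℤ) ^ j)) (k + 1 + 1)),
        IwasawaAlgebra.EisensteinCoeff.reduce p m (Nat.le_succ (k + 1)) ((D (k + 1)).e x y) =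
          (D k).e ((W.eisensteinTower κ hm).red k x) ((W.eisensteinTower κ hm).red k y))
    (k d : ℕ) (x y : EisensteinLevel p m (fun j ↦ geomTorsion (W.baseChange K) ((p : ℤ) ^ j)) (k + d + 1)) :
    letI := IwasawaAlgebra.isLocalRing_quotient_X_pow_add_C p hm
    IwasawaAlgebra.EisensteinCoeff.reduce p m (Nat.succ_le_succ (Nat.le_add_right k d)) ((D (k + d)).e x y) =
      (D k).e ((W.eisensteinTower κ hm).redIter k d x) ((W.eisensteinTower κ hm).redIter k d y) := by
  letI := IwasawaAlgebra.isLocalRing_quotient_X_pow_add_C p hm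
  induction d with
  | zero => exact IwasawaAlgebra.EisensteinCoeff.reduce_refl m (k + 1) _
  | succ d ih =>
    change _ = (D k).e ((W.eisensteinTower κ hm).redIter k d ((W.eisensteinTower κ hm).red (k + d) x))
      ((W.eisensteinTower κ hm).redIter k d ((W.eisensteinTower κ hm).red (k + d) y))
    rw [← ih, ← he_red (k + d) x y, IwasawaAlgebra.EisensteinCoeff.reduce_reduce]
    rfl

/-! ### §3 (Adj): the projection formula for the induced local pairings of the levels -/

/-- **(Adj) `H²(ι_d(1)) (x ∪_k H¹(red^{(d)}) w) = H¹(×p^d) x ∪_{k+d} w` at every place** — for H.4 data satisfying the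
reduction identity `he_red` of the setting and ANY value map `ι_d` with `ι_d ∘ reduce = p^d ·`:
`DualityDatum.localCup_map_adjoint'` at `u := F (k+1) (k+d+1)` (the division `×p^d : T^{(k)} ↪ T^{(k+d)}`),
`r := red^{(d)}`, `φ := ι_d`; its pairing clause `ι_d (e_k(s, red^{(d)} t)) = e_{k+d}(u s, t)` is `he_red^{(d)}`,
`u ∘ red^{(d)} = p^d ·` and bilinearity. [cite: Howard2004HeegnerKolyvagin, §1.3 H.4 (arXiv p. 7, L78–82) and §1.6 (p. 11, L33–38)]
[cite: NeukirchSchmidtWingberg2008, I §4 (1.4.2)–(1.4.6)] -/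
theorem eisensteinTower_localCup_adjoint
    (he_red : letI := IwasawaAlgebra.isLocalRing_quotient_X_pow_add_C p hm
      ∀ k (x y : EisensteinLevel p m (fun j ↦ geomTorsion (W.baseChange K) ((p : ℤ) ^ j)) (k + 1 + 1)),
        IwasawaAlgebra.EisensteinCoeff.reduce p m (Nat.le_succ (k + 1)) ((D (k + 1)).e x y) =
          (D k).e ((W.eisensteinTower κ hm).red k x) ((W.eisensteinTower κ hm).red k y))
    (k d : ℕ) (v : Place K)
    (ι : IwasawaAlgebra.EisensteinCoeff p m (k + 1) →+ IwasawaAlgebra.EisensteinCoeff p m (k + d + 1))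
    (hι : ∀ x : IwasawaAlgebra.EisensteinCoeff p m (k + d + 1),
      ι (IwasawaAlgebra.EisensteinCoeff.reduce p m (Nat.succ_le_succ (Nat.le_add_right k d)) x) = p ^ d • x)
    (x : letI := IwasawaAlgebra.isLocalRing_quotient_X_pow_add_C p hm
      galoisCohomology (((W.eisensteinTower κ hm).ρ k).toLocal v) 1)
    (w : letI := IwasawaAlgebra.isLocalRing_quotient_X_pow_add_C p hm
      galoisCohomology ((cd.twist ((W.eisensteinTower κ hm).ρ (k + d))).toLocal v) 1) :
    letI := IwasawaAlgebra.isLocalRing_quotient_X_pow_add_C p hm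
    ContinuousRep.cohomologyMap ((D k).twistOne.toLocal v) ((D (k + d)).twistOne.toLocal v) ι
        continuous_of_discreteTopology
        (fun _ z => (D k).twistOne_apply_of_apply_reduce (D (k + d)) _ ι (p ^ d) hι _ z) 2
        ((D k).localCup v x
          (ContinuousRep.cohomologyMap ((cd.twist ((W.eisensteinTower κ hm).ρ (k + d))).toLocal v)
            ((cd.twist ((W.eisensteinTower κ hm).ρ k)).toLocal v) ((W.eisensteinTower κ hm).redIter k d).toAddMonoidHom
            continuous_of_discreteTopology (fun _ z => (W.eisensteinTower κ hm).redIter_equivariant k d _ z) 1 w)) =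
      (D (k + d)).localCup v
        (galoisCohomology.map (DiscreteGaloisModule.localMap
          ((W.baseChange K).eisensteinTwistTorsionTransfer κ hm
            (fun j ↦ (W.baseChange K).torsionGaloisModuleReduce p j)
            (W.torsionGaloisModuleReduce_coe (K := K) (p := p)) (k + 1) (k + d + 1)) v) 1 x) w := by
  letI := IwasawaAlgebra.isLocalRing_quotient_X_pow_add_C p hm
  let F := (W.baseChange K).eisensteinTwistTorsionTransfer κ hm
    (fun j ↦ (W.baseChange K).torsionGaloisModuleReduce p j) (W.torsionGaloisModuleReduce_coe (K := K) (p := p))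
  have he : ∀ (s : EisensteinLevel p m (fun j ↦ geomTorsion (W.baseChange K) ((p : ℤ) ^ j)) (k + 1))
      (t : EisensteinLevel p m (fun j ↦ geomTorsion (W.baseChange K) ((p : ℤ) ^ j)) (k + d + 1)),
      ι ((D k).e s ((W.eisensteinTower κ hm).redIter k d t)) =
        (D (k + d)).e (F (k + 1) (k + d + 1)
          (s : IwasawaAlgebra.EisensteinCoeff.Twisted p m (k + 1) (geomTorsion (W.baseChange K) ((p : ℤ) ^ (k + 1)))))
          t := by
    intro s t
    obtain ⟨s', rfl⟩ := (W.eisensteinTower κ hm).redIter_surjective k d s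
    have h1 := W.reduce_e_redIter κ hm cd D he_red k d s' t
    have h2 := W.eisensteinTwistTorsionTransfer_redIter κ hm k d s'
    rw [← h1, hι]
    change _ = (D (k + d)).e (F (k + 1) (k + d + 1) _) t
    rw [h2, map_nsmul]
    rfl
  exact (D k).localCup_map_adjoint' (D (k + d))
    ((F (k + 1) (k + d + 1)).toContinuousLinearMap.toLinearMap.toAddMonoidHom)
    (fun g z => congrArg (fun φ ↦ φ z) ((F (k + 1) (k + d + 1)).isIntertwining' g))
    ((W.eisensteinTower κ hm).redIter k d).toAddMonoidHom
    (fun g z => (W.eisensteinTower κ hm).redIter_equivariant k d g z) ι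
    (fun g z => (D k).twistOne_apply_of_apply_reduce (D (k + d)) _ ι (p ^ d) hι g z) (fun s t => he s t) v x w

/-! ### §4 The package: `hAdj` of `Tower.mem_levelCondition_top_of_forall_pairing_bot_eq_zero_of_range` -/

/-- **The (Adj) level input of the H.4 descent for the curve's Eisenstein setting at a place `v`**: for the
`D`-indexed towers `X_j = H¹(K_v, T^{(j)})`, `Y_j = H¹(K_v, Tw T^{(j)})` (one-step maps `H¹(red_j)`), pairings
`B_j = (D j).localCup v`, the level maps `up d := H¹(K_v, F (k+1) (k+d+1))` (the divisions `×p^d : T^{(k)} ↪ T^{(k+d)}`,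
in the `galoisCohomology.map (localMap _ v) 1` currency of the (Ker) input `Tower.ker_map_up_le_levelCondition_bot`) and
the comparison maps `incQ d := H²(K_v, ι_d(1))` of ANY family of value maps `ι_d` with `ι_d ∘ reduce = p^d ·`
(`exists_forall_addMonoidHom_apply_reduce_eq_pow_smul`): LITERALLY the hypothesis
`hAdj : incQ d (B k x (redIter red′ k d w)) = B (k + d) (up d x) w`, for every base level `k` — given only the
reduction identity `he_red` of the H.4 data. [cite: Howard2004HeegnerKolyvagin, §1.3 H.4 (arXiv p. 7, L78–82), §1.6 (p. 11 L33–38, p. 12 L29–33) and Def. 3.1.2]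
[cite: NeukirchSchmidtWingberg2008, I §4 (1.4.2)–(1.4.6)] -/
theorem eisensteinTower_localCup_towerAdjoint
    (he_red : letI := IwasawaAlgebra.isLocalRing_quotient_X_pow_add_C p hm
      ∀ k (x y : EisensteinLevel p m (fun j ↦ geomTorsion (W.baseChange K) ((p : ℤ) ^ j)) (k + 1 + 1)),
        IwasawaAlgebra.EisensteinCoeff.reduce p m (Nat.le_succ (k + 1)) ((D (k + 1)).e x y) =
          (D k).e ((W.eisensteinTower κ hm).red k x) ((W.eisensteinTower κ hm).red k y))
    (v : Place K) (k : ℕ)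
    (ι : ∀ d : ℕ, IwasawaAlgebra.EisensteinCoeff p m (k + 1) →+ IwasawaAlgebra.EisensteinCoeff p m (k + d + 1))
    (hι : ∀ (d : ℕ) (x : IwasawaAlgebra.EisensteinCoeff p m (k + d + 1)),
      ι d (IwasawaAlgebra.EisensteinCoeff.reduce p m (Nat.succ_le_succ (Nat.le_add_right k d)) x) = p ^ d • x) :
    letI := IwasawaAlgebra.isLocalRing_quotient_X_pow_add_C p hm
    ∀ (d : ℕ) (x : galoisCohomology (((W.eisensteinTower κ hm).ρ k).toLocal v) 1)
      (w : galoisCohomology ((cd.twist ((W.eisensteinTower κ hm).ρ (k + d))).toLocal v) 1),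
      ContinuousRep.cohomologyMap ((D k).twistOne.toLocal v) ((D (k + d)).twistOne.toLocal v) (ι d)
          continuous_of_discreteTopology
          (fun _ z => (D k).twistOne_apply_of_apply_reduce (D (k + d)) _ (ι d) (p ^ d) (hι d) _ z) 2
          ((D k).localCup v x
            (Tower.redIter (H := fun j ↦ galoisCohomology ((cd.twist ((W.eisensteinTower κ hm).ρ j)).toLocal v) 1)
              (fun j ↦ ContinuousRep.cohomologyMap ((cd.twist ((W.eisensteinTower κ hm).ρ (j + 1))).toLocal v)
                ((cd.twist ((W.eisensteinTower κ hm).ρ j)).toLocal v) ((W.eisensteinTower κ hm).red j).toAddMonoidHom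
                continuous_of_discreteTopology (fun _ z => (W.eisensteinTower κ hm).red_equivariant j _ z) 1) k d w)) =
        (D (k + d)).localCup v
          (galoisCohomology.map (DiscreteGaloisModule.localMap
            ((W.baseChange K).eisensteinTwistTorsionTransfer κ hm
              (fun j ↦ (W.baseChange K).torsionGaloisModuleReduce p j)
              (W.torsionGaloisModuleReduce_coe (K := K) (p := p)) (k + 1) (k + d + 1)) v) 1 x) w := by
  letI := IwasawaAlgebra.isLocalRing_quotient_X_pow_add_C p hm
  intro d x w
  rw [(W.eisensteinTower κ hm).redIter_cohomologyMap_twist_toLocal_eq cd v k d w]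
  exact W.eisensteinTower_localCup_adjoint κ hm cd D he_red k d v (ι d) (hι d) x w

/-- **(Adj) with its value maps, existentially**: at every place `v` and base level `k` there are comparison maps
`incQ d : H²(K_v, A_{m,k+1}(1)) → H²(K_v, A_{m,k+d+1}(1))` (namely `H²(K_v, ι_d(1))`, `ι_d ∘ reduce = p^d ·`) such that
`incQ d (B k x (redIter red′ k d w)) = B (k + d) (up d x) w` with `up d := H¹(K_v, F (k+1) (k+d+1))` — the form
consumed by `Tower.mem_levelCondition_top_of_forall_pairing_bot_eq_zero_of_range` (which quantifies `incQ` only through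
`hAdj`). [cite: Howard2004HeegnerKolyvagin, §1.3 H.4 (arXiv p. 7, L78–82) and §1.6 (p. 11 L33–38)]
[cite: NeukirchSchmidtWingberg2008, I §4 (1.4.2)–(1.4.6)] -/
theorem eisensteinTower_exists_incQ_localCup_towerAdjoint
    (he_red : letI := IwasawaAlgebra.isLocalRing_quotient_X_pow_add_C p hm
      ∀ k (x y : EisensteinLevel p m (fun j ↦ geomTorsion (W.baseChange K) ((p : ℤ) ^ j)) (k + 1 + 1)),
        IwasawaAlgebra.EisensteinCoeff.reduce p m (Nat.le_succ (k + 1)) ((D (k + 1)).e x y) =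
          (D k).e ((W.eisensteinTower κ hm).red k x) ((W.eisensteinTower κ hm).red k y))
    (v : Place K) (k : ℕ) :
    letI := IwasawaAlgebra.isLocalRing_quotient_X_pow_add_C p hm
    ∃ incQ : ∀ d : ℕ, galoisCohomology ((D k).twistOne.toLocal v) 2 →+
        galoisCohomology ((D (k + d)).twistOne.toLocal v) 2,
      ∀ (d : ℕ) (x : galoisCohomology (((W.eisensteinTower κ hm).ρ k).toLocal v) 1)
        (w : galoisCohomology ((cd.twist ((W.eisensteinTower κ hm).ρ (k + d))).toLocal v) 1),
        incQ d ((D k).localCup v x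
            (Tower.redIter (H := fun j ↦ galoisCohomology ((cd.twist ((W.eisensteinTower κ hm).ρ j)).toLocal v) 1)
              (fun j ↦ ContinuousRep.cohomologyMap ((cd.twist ((W.eisensteinTower κ hm).ρ (j + 1))).toLocal v)
                ((cd.twist ((W.eisensteinTower κ hm).ρ j)).toLocal v) ((W.eisensteinTower κ hm).red j).toAddMonoidHom
                continuous_of_discreteTopology (fun _ z => (W.eisensteinTower κ hm).red_equivariant j _ z) 1) k d w)) =
          (D (k + d)).localCup v
            (galoisCohomology.map (DiscreteGaloisModule.localMap
              ((W.baseChange K).eisensteinTwistTorsionTransfer κ hm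
                (fun j ↦ (W.baseChange K).torsionGaloisModuleReduce p j)
                (W.torsionGaloisModuleReduce_coe (K := K) (p := p)) (k + 1) (k + d + 1)) v) 1 x) w := by
  letI := IwasawaAlgebra.isLocalRing_quotient_X_pow_add_C p hm
  obtain ⟨ι, hι⟩ := IwasawaAlgebra.EisensteinCoeff.exists_forall_addMonoidHom_apply_reduce_eq_pow_smul (p := p) m k
  exact ⟨fun d ↦ ContinuousRep.cohomologyMap ((D k).twistOne.toLocal v) ((D (k + d)).twistOne.toLocal v) (ι d)
      continuous_of_discreteTopology
      (fun _ z => (D k).twistOne_apply_of_apply_reduce (D (k + d)) _ (ι d) (p ^ d) (hι d) _ z) 2,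
    W.eisensteinTower_localCup_towerAdjoint κ hm cd D he_red v k ι hι⟩

end WeierstrassCurve

end
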